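import Summits.FinalStateConjecture.FinalStateConjecture.Theses.PhotonSphereChannels
import Literature.Geometry.Lorentzian.KerrSchildDivergence

/-!
# The stationary Killing field is timelike on the axis of every boosted Kerr–Schild exterior
(negative-side support for crux `TameCensorship`, `stmt-FinalStateConjecture-10047`, cdisprove seat, cycle 3)

Non-vacuity of the timelike-Killing hypothesis `g_B(x₀)(Λ e₀, Λ e₀) < 0` shared by the registered stubs
`stub_immortalObservers` (O), `stub_phaseRigidity` (P) and `stub_residue` (R) of line
`crush-the-swallowed-interior` (and by clause (iii) of the crux read along Killing orbits): in EVERY boosted,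
translated Kerr–Schild exterior `boostedKerrBackground Λ c M a` (all `Λ ∈ O(1,3)`, `c`, and all real `M, a`,
junk parameters included) the background form is negative on `Λ e₀` at the boosted axis points
`Λ (t, 0, 0, R) + c`, `R > max r₊ 0`.

* `axisPt t R = (t, 0, 0, R)` (local notation for `t • ∂₀ + R • ∂₃`, no definition); `radius_axisPt : r(a, (t,0,0,R)) = R` (`R > 0`);
* `kerrBilin_e0_e0 : g_{M,a}(∂_t, ∂_t) = −1 + 2H`;
* `kerrBilin_e0_e0_axisPt : g_{M,a}(∂_t, ∂_t)(t,0,0,R) = −(R² − 2MR + a²)/(R² + a²)` (`= −Δ/(r² + a²)`);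
* `kerrDelta_pos_of_rPlus_lt : r₊ < R → 0 < R² − 2MR + a²` (all `M, a`);
* `kerrBilin_e0_e0_axisPt_neg`, `axisPt_mem_exterior`, and the packaged
  `exists_boostedKerr_killing_timelike` (stated with `EuclideanSpace.single 0 1` verbatim as in the def-free
  stubs);
* `stubP_exactness_empty`, `stubP_conclusion_empty`: at `E = ∅` stub P's exactness hypotheses hold for every
  `χ` and its orbit conclusion is trivial, so P specialised to `E = ∅` IS the existence of a timelike-Killing
  point — discharged by `exists_boostedKerr_killing_timelike` (P's intended polar points `R ∈ (M', (1+η)M')`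
  of the extremal background, `r₊ = M'`, are covered by `kerrBilin_e0_e0_axisPt_neg`).
-/

noncomputable section

open Bundle TopologicalSpace Manifold Set
open scoped ContDiff Topology

namespace Summit.FinalStateConjecture.FinalStateConjecture.Theorems.TameCensorship.Negative

open Literature.Geometry.Lorentzian

/-- The axis point `(t, 0, 0, R)` of the Kerr–Schild chart `E4` (local notation, no new definition:
`axisPt t R` is literally `t • ∂₀ + R • ∂₃`). -/
local notation "axisPt" => fun (t R : ℝ) ↦ (t • E4.basisVector 0 + R • E4.basisVector 3 : E4)

/-- Time coordinate of the axis point. -/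
@[simp] theorem axisPt_apply_zero (t R : ℝ) : axisPt t R 0 = t := by simp

/-- `x¹`-coordinate of the axis point. -/
@[simp] theorem axisPt_apply_one (t R : ℝ) : axisPt t R 1 = 0 := by simp

/-- `x²`-coordinate of the axis point. -/
@[simp] theorem axisPt_apply_two (t R : ℝ) : axisPt t R 2 = 0 := by simp

/-- `x³`-coordinate of the axis point. -/
@[simp] theorem axisPt_apply_three (t R : ℝ) : axisPt t R 3 = R := by simp

/-- `‖x⃗‖² = R²` on the axis. -/
theorem spatialNorm_sq_axisPt (t R : ℝ) : E4.spatialNorm (axisPt t R) ^ 2 = R ^ 2 := by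
  rw [E4.spatialNorm_sq]; simp

/-- On the axis the Kerr–Schild radius is `|z|`: `r(t, 0, 0, R) = R` for `R > 0` (the defining quartic
degenerates to `R⁴ − (R² − a²)R² − a²R² = 0`). -/
theorem radius_axisPt (a t : ℝ) {R : ℝ} (hR : 0 < R) : Kerr.radius a (axisPt t R) = R := by
  apply Kerr.radius_eq_of_pos_of_quartic hR
  rw [spatialNorm_sq_axisPt, axisPt_apply_three]
  ring

/-- `g_{M,a}(∂_t, ∂_t) = −1 + 2H` in the ingoing Kerr–Schild chart (`ℓ(∂_t) = 1`). -/
theorem kerrBilin_e0_e0 (M a : ℝ) (x : E4) :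
    Kerr.bilin M a x (E4.basisVector 0) (E4.basisVector 0) = -1 + 2 * Kerr.scalarH M a x := by
  rw [Kerr.bilin_apply, Kerr.nullCovector_basisVector_zero, Minkowski.bilin_basisVector_zero]
  ring

/-- **Exact axis formula**: `g_{M,a}(∂_t, ∂_t)(t, 0, 0, R) = −(R² − 2MR + a²)/(R² + a²)`
(`= −Δ(R)/(R² + a²)`, the Boyer–Lindquist `g_{tt}` on the axis), for every `M, a` and `R > 0`. -/
theorem kerrBilin_e0_e0_axisPt (M a t : ℝ) {R : ℝ} (hR : 0 < R) :
    Kerr.bilin M a (axisPt t R) (E4.basisVector 0) (E4.basisVector 0) =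
      -(R ^ 2 - 2 * M * R + a ^ 2) / (R ^ 2 + a ^ 2) := by
  rw [kerrBilin_e0_e0, Kerr.scalarH, radius_axisPt a t hR, axisPt_apply_three]
  have h1 : R ^ 2 + a ^ 2 ≠ 0 := by positivity
  have h2 : R ^ 4 + a ^ 2 * R ^ 2 = R ^ 2 * (R ^ 2 + a ^ 2) := by ring
  rw [h2]
  field_simp
  ring

/-- `Δ(R) = R² − 2MR + a² > 0` beyond the outer horizon radius `r₊ = M + √(M² − a²)`, for ALL real
`M, a` (junk parameters included: for `a² > M²` the square root vanishes and `Δ > (R − M)² ≥ 0`). -/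
theorem kerrDelta_pos_of_rPlus_lt {M a R : ℝ} (hR : Kerr.rPlus M a < R) :
    0 < R ^ 2 - 2 * M * R + a ^ 2 := by
  unfold Kerr.rPlus at hR
  have hs : 0 ≤ √(M ^ 2 - a ^ 2) := Real.sqrt_nonneg _
  rcases le_or_gt 0 (M ^ 2 - a ^ 2) with h | h
  · have hsq : √(M ^ 2 - a ^ 2) ^ 2 = M ^ 2 - a ^ 2 := Real.sq_sqrt h
    nlinarith
  · nlinarith

/-- **The stationary Killing field `∂_t` is timelike at every axis point beyond the horizon**
(`R > max r₊ 0`), for every `M, a`: the ergoregion touches the axis only at the poles of the horizon. -/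
theorem kerrBilin_e0_e0_axisPt_neg (M a t : ℝ) {R : ℝ} (hR : 0 < R) (hR' : Kerr.rPlus M a < R) :
    Kerr.bilin M a (axisPt t R) (E4.basisVector 0) (E4.basisVector 0) < 0 := by
  rw [kerrBilin_e0_e0_axisPt M a t hR, neg_div]
  exact neg_neg_of_pos (div_pos (kerrDelta_pos_of_rPlus_lt hR') (by positivity))

/-- Axis points beyond `r₊` lie in the Kerr exterior `{r > max r₊ 0}`. -/
theorem axisPt_mem_exterior (M a t : ℝ) {R : ℝ} (hR : 0 < R) (hR' : Kerr.rPlus M a < R) :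
    axisPt t R ∈ Kerr.exterior M a := by
  rw [Kerr.mem_exterior, radius_axisPt a t hR]
  exact max_lt hR' hR

/-- **Non-vacuity of the timelike-Killing hypothesis of stubs O / P / R.** In EVERY boosted, translated
Kerr–Schild exterior (all `Λ ∈ O(1,3)`, `c`, `M`, `a`, junk parameters included) there is a point `x₀` at
which the stationary Killing direction `Λ e₀` is timelike for the background form — the boosted axis
point `Λ (0, 0, 0, R) + c` with `R = max r₊ 0 + 1`. Stated with `EuclideanSpace.single 0 1` verbatim as in
the registered (def-free) stubs. -/
theorem exists_boostedKerr_killing_timelike (Λ : lorentzGroup) (c : E4) (M a : ℝ) :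
    ∃ x₀ : (boostedKerrBackground Λ c M a).domain,
      (boostedKerrBackground Λ c M a).bilin x₀.1
        ((Λ : E4 ≃L[ℝ] E4) (EuclideanSpace.single (0 : Fin 4) (1 : ℝ)))
        ((Λ : E4 ≃L[ℝ] E4) (EuclideanSpace.single (0 : Fin 4) (1 : ℝ))) < 0 := by
  set R : ℝ := max (Kerr.rPlus M a) 0 + 1 with hRdef
  have hR : 0 < R := by rw [hRdef]; linarith [le_max_right (Kerr.rPlus M a) 0]
  have hR' : Kerr.rPlus M a < R := by rw [hRdef]; linarith [le_max_left (Kerr.rPlus M a) 0]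
  set y : E4 := axisPt 0 R with hy
  have hinv : poincareInv Λ c ((Λ : E4 ≃L[ℝ] E4) y + c) = y := by
    simp [poincareInv]
  have hmem : (Λ : E4 ≃L[ℝ] E4) y + c ∈ (boostedKerrBackground Λ c M a).domain := by
    change (Λ : E4 ≃L[ℝ] E4) y + c ∈ boostedKerrExterior Λ c M a
    rw [mem_boostedKerrExterior, hinv]
    exact axisPt_mem_exterior M a 0 hR hR'
  refine ⟨⟨_, hmem⟩, ?_⟩
  change boostedKerrBilin Λ c M a ((Λ : E4 ≃L[ℝ] E4) y + c) _ _ < 0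
  rw [boostedKerrBilin_apply, hinv, ContinuousLinearEquiv.symm_apply_apply]
  exact kerrBilin_e0_e0_axisPt_neg M a 0 hR hR'

/-- **Stub P keeps content at `E = ∅`**: its three exactness hypotheses (`IsOpen E`, `ContMDiffOn χ E`,
`χ^* g_{M,a} = g` on `E`) hold for `E = ∅` and EVERY `χ`, so P specialised there asserts, for every
spacetime admitting an extremal late chart with near-zone deviation `→ 0`, the existence of a
timelike-Killing point of the boosted extremal exterior (`exists_boostedKerr_killing_timelike`). -/
theorem stubP_exactness_empty [Kerr.Facts] (𝓢 : Spacetime.{0} 4) (M a : ℝ) (hM : 0 ≤ M)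
    (χ : 𝓢.carrier → (Kerr.spacetime M a (Kerr.rMinus M a) hM).carrier) :
    IsOpen (∅ : Set 𝓢.carrier) ∧ ContMDiffOn (𝓡 4) (𝓡 4) ∞ χ ∅ ∧
      ∀ p ∈ (∅ : Set 𝓢.carrier), pullbackBilin (I := 𝓡 4) (I' := 𝓡 4) χ
        (Kerr.spacetime M a (Kerr.rMinus M a) hM).metric.val p = 𝓢.metric.val p :=
  ⟨isOpen_empty, contMDiffOn_empty, fun _ h ↦ h.elim⟩

/-- The orbit conclusion of stub P at `E = ∅` is trivially true, for every curve and every side condition. -/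
theorem stubP_conclusion_empty {𝓢 : Spacetime.{0} 4} (γ : ℝ → 𝓢.carrier) (Q : ℝ → Prop) :
    ¬ ∃ s₀ : ℝ, ∀ s : ℝ, s₀ ≤ s → γ s ∈ (∅ : Set 𝓢.carrier) ∧ Q s :=
  fun ⟨s₀, h⟩ ↦ (h s₀ le_rfl).1

end Summit.FinalStateConjecture.FinalStateConjecture.Theorems.TameCensorship.Negative

end
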